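import Summits.ValiantsHypothesis.ValiantsHypothesis.Theorems.FeketeSOSFeketeSOSHardPaleyRIPTraceFour
import Summits.ValiantsHypothesis.ValiantsHypothesis.Theorems.FeketeSOSFeketeSOSHardPaleyRIPSubsetCounting

/-!
# Route FeketeSOS — crux `FeketeSOSHard` (stmt-ValiantsHypothesis-3996), line `paley-rip` (v3),
# stub `stub_paleyFlatRIP`: the engine holds for ALMOST ALL supports of each size (fourth moment)

The engine `stub_paleyFlatRIP` asks for `|Q_p(S,w)| ≤ p^{1/2−κ} Σ_{a∈S}|w_a|²` for EVERY `S ⊆ [0,p)` with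
`#S ≤ p^{1/2+δ₁}` — for adversarial supports this is the Paley graph conjecture below `1/2` (open; see
`…PaleyGraphConjecture.lean`).  This file proves, unconditionally and by elementary means, that the
inequality holds for all but a vanishing proportion of the supports of each admissible size — the standard
"random subsets of a bounded orthogonal system are restricted isometries" heuristic at the level of the
fourth moment (inputs: `…PaleyRIPTraceFour` for `|Q|⁴ ≤ tr(H_S⁴)‖w‖⁸` and the complete cycle sum `≤ 2p³`;
`…PaleyRIPSubsetCounting` for the averaging over `m`-subsets).

* `sum_trace_four_le` — **fourth moment over supports**: for `4 ≤ m`,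
  `Σ_{S ⊆ [0,p), #S = m} tr(H_S⁴) ≤ 8p³·C(p−4, m−4) + 6m³·C(p, m)`, i.e. `E_S tr(H_S⁴) ≲ 8m⁴/p + 6m³`
  (exchange of sums; injective 4-tuples are each counted `C(p−4,m−4)` times and their complete sum has
  square-root cancellation; non-injective 4-tuples — `≤ 6m³` per support, `≤ 6p³` overall — are bounded
  trivially);
* `card_badSupports_mul_le` — Markov: `#{S : #S = m, ∃ w, |Q_p(S,w)| > L·Σ|w_a|²} · L⁴ ≤ 8p³C(p−4,m−4) + 6m³C(p,m)`;
* `flatRIP_randomSupport` — **asymptotic form**: for `κ, δ₁, η > 0` with `4κ + 3δ₁ + η < 1/2` and all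
  large primes `p`, for every `m ≤ p^{1/2+δ₁}` the engine inequality with exponent `κ` fails (for some
  complex `w`) on at most `p^{−η}·C(p,m)` of the `C(p,m)` supports `S ⊆ [0,p)` of size `m`.

With `…PaleyRIPBurgessRange` (structured supports: short progressions, conditionally on the published mixed
Burgess bound) and `…PaleyGraphConjecture` (adversarial supports = the named conjecture) this completes the
kernel picture of the engine by support class.  Higher moments `tr(H_S^{2k})` would push the generic region
`4κ + 3δ₁ < 1/2` towards the conjectured `κ + δ₁/2 < 1/4` but need character sums with `2k` linear factors
(Weil), not attempted here.

Honest framing (rung currency): Theorems-side helper `--supports` stmt-3996; an average-case statement does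
not compose with the crux (a cheap representation chooses its support); the engine (all supports),
`stub_tameOperator` and the crux stay OPEN; `VP ≠ VNP` is untouched.
-/

set_option linter.dupNamespace false

namespace Summit.ValiantsHypothesis.ValiantsHypothesis.Theorems.FeketeSOSHardPaleyRIP

open Finset Complex
open scoped BigOperators ComplexConjugate

noncomputable section

/-! ## The fourth moment over all supports of size `m` -/

section FourthMoment

variable (p : ℕ) [Fact p.Prime]

/-- The cycle product `χ(a+b)χ(b+c)χ(c+d)χ(d+a)` has modulus `≤ 1`. [folklore] -/
theorem norm_cycle_le_one (a b c d : ℕ) :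
    ‖((quadraticChar (ZMod p) ((a : ZMod p) + (b : ZMod p)) : ℤ) : ℂ) *
        ((quadraticChar (ZMod p) ((b : ZMod p) + (c : ZMod p)) : ℤ) : ℂ) *
        ((quadraticChar (ZMod p) ((c : ZMod p) + (d : ZMod p)) : ℤ) : ℂ) *
        ((quadraticChar (ZMod p) ((d : ZMod p) + (a : ZMod p)) : ℤ) : ℂ)‖ ≤ 1 := by
  rw [norm_mul, norm_mul, norm_mul]
  have h1 := norm_chi_le_one p ((a : ZMod p) + (b : ZMod p))
  have h2 := norm_chi_le_one p ((b : ZMod p) + (c : ZMod p))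
  have h3 := norm_chi_le_one p ((c : ZMod p) + (d : ZMod p))
  have h4 := norm_chi_le_one p ((d : ZMod p) + (a : ZMod p))
  exact mul_le_one₀ (mul_le_one₀ (mul_le_one₀ h1 (norm_nonneg _) h2) (norm_nonneg _) h3)
    (norm_nonneg _) h4

/-- **Fourth moment of the Paley–Hankel blocks over all supports of size `m`.**  For `4 ≤ m`,
`Σ_{S ⊆ [0,p), #S = m} tr(H_S⁴) ≤ 8p³·C(p−4, m−4) + 6m³·C(p, m)`; i.e. on average over `S`,
`tr(H_S⁴) ≲ 8m⁴/p + 6m³` — square-root cancellation in the generic block, as for a random sign matrix.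
(Exchange the sums; injective 4-tuples are each counted `C(p−4,m−4)` times and their complete sum is
`≤ 2p³` by `norm_cycleSum_range_le`; the `≤ 6m³` non-injective 4-tuples per support and the `≤ 6p³`
non-injective 4-tuples overall are bounded trivially.) [folklore] -/
theorem sum_trace_four_le (m : ℕ) (hm : 4 ≤ m) :
    ∑ S ∈ powersetCard m (range p),
      (∑ b ∈ S, ∑ d ∈ S, ‖∑ a ∈ S, ((quadraticChar (ZMod p) ((a : ZMod p) + (b : ZMod p)) : ℤ) : ℂ) *
          ((quadraticChar (ZMod p) ((a : ZMod p) + (d : ZMod p)) : ℤ) : ℂ)‖ ^ 2) ≤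
      8 * (p : ℝ) ^ 3 * (((p - 4).choose (m - 4) : ℕ) : ℝ) + 6 * (m : ℝ) ^ 3 * ((p.choose m : ℕ) : ℝ) := by
  classical
  set U : Finset ℕ := range p with hU
  set K : ℕ → ℕ → ℂ := fun a b => ((quadraticChar (ZMod p) ((a : ZMod p) + (b : ZMod p)) : ℤ) : ℂ)
    with hK
  set f : ℕ → ℕ → ℕ → ℕ → ℂ := fun a b c d => K a b * K b c * K c d * K d a with hf
  set N : ℕ → ℕ → ℕ → ℕ → ℕ := fun a b c d =>
    ((powersetCard m U).filter (fun S => a ∈ S ∧ b ∈ S ∧ c ∈ S ∧ d ∈ S)).card with hN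
  set N4 : ℕ := (p - 4).choose (m - 4) with hN4
  set ind : ℕ → ℕ → ℕ → ℕ → ℝ := fun a b c d =>
    if (a = b ∨ a = c ∨ a = d ∨ b = c ∨ b = d ∨ c = d) then (1 : ℝ) else 0 with hind
  have hUcard : U.card = p := card_range p
  have hp0 : (0 : ℝ) ≤ (p : ℝ) := Nat.cast_nonneg _
  -- Step A: the left side is `Re Σ_{U⁴} N·f`
  have hA : ∑ S ∈ powersetCard m U, (∑ b ∈ S, ∑ d ∈ S, ‖∑ a ∈ S, K a b * K a d‖ ^ 2) =
      (∑ a ∈ U, ∑ b ∈ U, ∑ c ∈ U, ∑ d ∈ U, (N a b c d : ℂ) * f a b c d).re := by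
    rw [← sum_powersetCard_quad U m f, Complex.re_sum]
    exact Finset.sum_congr rfl fun S _ => trace_four_eq_re_cycleSum p S
  -- Step B: split `N = N4 + (N − N4)`
  have hsplit : ∑ a ∈ U, ∑ b ∈ U, ∑ c ∈ U, ∑ d ∈ U, (N a b c d : ℂ) * f a b c d =
      (∑ a ∈ U, ∑ b ∈ U, ∑ c ∈ U, ∑ d ∈ U, (N4 : ℂ) * f a b c d) +
      ∑ a ∈ U, ∑ b ∈ U, ∑ c ∈ U, ∑ d ∈ U, ((N a b c d : ℂ) - N4) * f a b c d := by
    have hpt : ∀ a b c d : ℕ, (N a b c d : ℂ) * f a b c d =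
        (N4 : ℂ) * f a b c d + ((N a b c d : ℂ) - N4) * f a b c d := by
      intro a b c d; ring
    simp only [hpt, Finset.sum_add_distrib]
  -- Step C: the main term
  have hmain : ‖∑ a ∈ U, ∑ b ∈ U, ∑ c ∈ U, ∑ d ∈ U, (N4 : ℂ) * f a b c d‖ ≤ (N4 : ℝ) * (2 * (p : ℝ) ^ 3) := by
    rw [show (∑ a ∈ U, ∑ b ∈ U, ∑ c ∈ U, ∑ d ∈ U, (N4 : ℂ) * f a b c d) =
        (N4 : ℂ) * ∑ a ∈ U, ∑ b ∈ U, ∑ c ∈ U, ∑ d ∈ U, f a b c d by simp only [Finset.mul_sum],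
      norm_mul, Complex.norm_natCast]
    exact mul_le_mul_of_nonneg_left (norm_cycleSum_range_le p) (Nat.cast_nonneg _)
  -- Step D: the error term, pointwise
  have hpt : ∀ a ∈ U, ∀ b ∈ U, ∀ c ∈ U, ∀ d ∈ U,
      ‖((N a b c d : ℂ) - N4) * f a b c d‖ ≤ ind a b c d * ((N a b c d : ℝ) + N4) := by
    intro a ha b hb c hc d hd
    by_cases h : (a = b ∨ a = c ∨ a = d ∨ b = c ∨ b = d ∨ c = d)
    · simp only [hind, if_pos h, one_mul]
      rw [norm_mul]
      have hf1 : ‖f a b c d‖ ≤ 1 := norm_cycle_le_one p a b c d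
      have hNN : ‖(N a b c d : ℂ) - N4‖ ≤ (N a b c d : ℝ) + N4 := by
        refine (norm_sub_le _ _).trans ?_
        rw [Complex.norm_natCast, Complex.norm_natCast]
      calc ‖(N a b c d : ℂ) - N4‖ * ‖f a b c d‖ ≤ ((N a b c d : ℝ) + N4) * 1 :=
            mul_le_mul hNN hf1 (norm_nonneg _) (by positivity)
        _ = (N a b c d : ℝ) + N4 := mul_one _
    · simp only [hind, if_neg h, zero_mul]
      push Not at h
      obtain ⟨hab, hac, had, hbc, hbd, hcd⟩ := h
      have hNeq : N a b c d = N4 := by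
        simp only [hN, hN4]
        rw [card_powersetCard_mem_four U m hm ha hb hc hd hab hac had hbc hbd hcd, hUcard]
      rw [hNeq, sub_self, zero_mul, norm_zero]
  -- Step E: summing the error term
  have hindN : ∑ a ∈ U, ∑ b ∈ U, ∑ c ∈ U, ∑ d ∈ U, ind a b c d * (N a b c d : ℝ) ≤
      6 * (m : ℝ) ^ 3 * ((p.choose m : ℕ) : ℝ) := by
    have hx : ∑ a ∈ U, ∑ b ∈ U, ∑ c ∈ U, ∑ d ∈ U, ind a b c d * (N a b c d : ℝ) =
        ∑ S ∈ powersetCard m U, ∑ a ∈ S, ∑ b ∈ S, ∑ c ∈ S, ∑ d ∈ S, ind a b c d := by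
      rw [sum_powersetCard_quad U m ind]
      refine Finset.sum_congr rfl fun a _ => Finset.sum_congr rfl fun b _ =>
        Finset.sum_congr rfl fun c _ => Finset.sum_congr rfl fun d _ => ?_
      rw [hN, mul_comm]
    rw [hx]
    calc ∑ S ∈ powersetCard m U, ∑ a ∈ S, ∑ b ∈ S, ∑ c ∈ S, ∑ d ∈ S, ind a b c d
        ≤ ∑ S ∈ powersetCard m U, 6 * (m : ℝ) ^ 3 := by
          refine Finset.sum_le_sum fun S hS => ?_
          have hSm : S.card = m := (mem_powersetCard.1 hS).2
          have := quad_noninj_le S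
          rw [hSm] at this
          exact this
      _ = 6 * (m : ℝ) ^ 3 * ((p.choose m : ℕ) : ℝ) := by
          rw [Finset.sum_const, card_powersetCard, hUcard, nsmul_eq_mul]; ring
  have hindU : ∑ a ∈ U, ∑ b ∈ U, ∑ c ∈ U, ∑ d ∈ U, ind a b c d ≤ 6 * (p : ℝ) ^ 3 := by
    have := quad_noninj_le U
    rw [hUcard] at this
    exact this
  have herr : ‖∑ a ∈ U, ∑ b ∈ U, ∑ c ∈ U, ∑ d ∈ U, ((N a b c d : ℂ) - N4) * f a b c d‖ ≤
      6 * (m : ℝ) ^ 3 * ((p.choose m : ℕ) : ℝ) + (N4 : ℝ) * (6 * (p : ℝ) ^ 3) := by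
    calc ‖∑ a ∈ U, ∑ b ∈ U, ∑ c ∈ U, ∑ d ∈ U, ((N a b c d : ℂ) - N4) * f a b c d‖
        ≤ ∑ a ∈ U, ∑ b ∈ U, ∑ c ∈ U, ∑ d ∈ U, ‖((N a b c d : ℂ) - N4) * f a b c d‖ := by
          refine (norm_sum_le _ _).trans (Finset.sum_le_sum fun a _ => ?_)
          refine (norm_sum_le _ _).trans (Finset.sum_le_sum fun b _ => ?_)
          refine (norm_sum_le _ _).trans (Finset.sum_le_sum fun c _ => ?_)
          exact norm_sum_le _ _
      _ ≤ ∑ a ∈ U, ∑ b ∈ U, ∑ c ∈ U, ∑ d ∈ U, ind a b c d * ((N a b c d : ℝ) + N4) :=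
          Finset.sum_le_sum fun a ha => Finset.sum_le_sum fun b hb => Finset.sum_le_sum fun c hc =>
            Finset.sum_le_sum fun d hd => hpt a ha b hb c hc d hd
      _ = (∑ a ∈ U, ∑ b ∈ U, ∑ c ∈ U, ∑ d ∈ U, ind a b c d * (N a b c d : ℝ)) +
            (N4 : ℝ) * ∑ a ∈ U, ∑ b ∈ U, ∑ c ∈ U, ∑ d ∈ U, ind a b c d := by
          have hdist : ∀ a b c d : ℕ, ind a b c d * ((N a b c d : ℝ) + N4) =
              ind a b c d * (N a b c d : ℝ) + (N4 : ℝ) * ind a b c d := by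
            intro a b c d; ring
          simp only [hdist, Finset.sum_add_distrib, Finset.mul_sum]
      _ ≤ 6 * (m : ℝ) ^ 3 * ((p.choose m : ℕ) : ℝ) + (N4 : ℝ) * (6 * (p : ℝ) ^ 3) :=
          add_le_add hindN (mul_le_mul_of_nonneg_left hindU (Nat.cast_nonneg _))
  -- Step F: assemble
  show ∑ S ∈ powersetCard m U, (∑ b ∈ S, ∑ d ∈ S, ‖∑ a ∈ S, K a b * K a d‖ ^ 2) ≤
      8 * (p : ℝ) ^ 3 * (N4 : ℝ) + 6 * (m : ℝ) ^ 3 * ((p.choose m : ℕ) : ℝ)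
  rw [hA, hsplit, Complex.add_re]
  have hre1 := Complex.re_le_norm (∑ a ∈ U, ∑ b ∈ U, ∑ c ∈ U, ∑ d ∈ U, (N4 : ℂ) * f a b c d)
  have hre2 := Complex.re_le_norm
    (∑ a ∈ U, ∑ b ∈ U, ∑ c ∈ U, ∑ d ∈ U, ((N a b c d : ℂ) - N4) * f a b c d)
  nlinarith [hmain, herr, hre1, hre2, hp0]

end FourthMoment

/-! ## Markov: few supports violate the engine inequality -/

section RandomSupport

variable (p : ℕ) [Fact p.Prime]

/-- `tr(H_S⁴) ≤ (#S)⁴` trivially. [folklore] -/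
theorem trace_four_le_card_pow (S : Finset ℕ) :
    (∑ b ∈ S, ∑ d ∈ S, ‖∑ a ∈ S, ((quadraticChar (ZMod p) ((a : ZMod p) + (b : ZMod p)) : ℤ) : ℂ) *
        ((quadraticChar (ZMod p) ((a : ZMod p) + (d : ZMod p)) : ℤ) : ℂ)‖ ^ 2) ≤ (S.card : ℝ) ^ 4 := by
  have hin : ∀ b d : ℕ, ‖∑ a ∈ S, ((quadraticChar (ZMod p) ((a : ZMod p) + (b : ZMod p)) : ℤ) : ℂ) *
      ((quadraticChar (ZMod p) ((a : ZMod p) + (d : ZMod p)) : ℤ) : ℂ)‖ ^ 2 ≤ (S.card : ℝ) ^ 2 := by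
    intro b d
    refine pow_le_pow_left₀ (norm_nonneg _) ?_ 2
    calc _ ≤ ∑ a ∈ S, ‖((quadraticChar (ZMod p) ((a : ZMod p) + (b : ZMod p)) : ℤ) : ℂ) *
          ((quadraticChar (ZMod p) ((a : ZMod p) + (d : ZMod p)) : ℤ) : ℂ)‖ := norm_sum_le _ _
      _ ≤ ∑ a ∈ S, (1 : ℝ) := Finset.sum_le_sum fun a _ => by
          rw [norm_mul]
          exact mul_le_one₀ (norm_chi_le_one p _) (norm_nonneg _) (norm_chi_le_one p _)
      _ = S.card := by simp
  calc _ ≤ ∑ b ∈ S, ∑ d ∈ S, (S.card : ℝ) ^ 2 :=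
        Finset.sum_le_sum fun b _ => Finset.sum_le_sum fun d _ => hin b d
    _ = (S.card : ℝ) ^ 4 := by simp [Finset.sum_const]; ring

open Classical in
/-- **Markov bound for the bad supports.**  For `4 ≤ m` and `L ≥ 0`, the number of supports
`S ⊆ [0,p)` with `#S = m` on which some complex weight `w` violates `|Q_p(S,w)| ≤ L·Σ_{a∈S}|w_a|²`,
multiplied by `L⁴`, is at most `8p³·C(p−4, m−4) + 6m³·C(p, m)`. [folklore] -/
theorem card_badSupports_mul_le (m : ℕ) (hm : 4 ≤ m) (L : ℝ) (hL : 0 ≤ L) :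
    ((((powersetCard m (range p)).filter (fun S => ¬ ∀ w : ℕ → ℂ,
        ‖paleyForm p S w‖ ≤ L * ∑ a ∈ S, ‖w a‖ ^ 2)).card : ℝ)) * L ^ 4 ≤
      8 * (p : ℝ) ^ 3 * (((p - 4).choose (m - 4) : ℕ) : ℝ) + 6 * (m : ℝ) ^ 3 * ((p.choose m : ℕ) : ℝ) := by
  set T4 : Finset ℕ → ℝ := fun S =>
    ∑ b ∈ S, ∑ d ∈ S, ‖∑ a ∈ S, ((quadraticChar (ZMod p) ((a : ZMod p) + (b : ZMod p)) : ℤ) : ℂ) *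
      ((quadraticChar (ZMod p) ((a : ZMod p) + (d : ZMod p)) : ℤ) : ℂ)‖ ^ 2 with hT4
  set bad := (powersetCard m (range p)).filter (fun S => ¬ ∀ w : ℕ → ℂ,
    ‖paleyForm p S w‖ ≤ L * ∑ a ∈ S, ‖w a‖ ^ 2) with hbad
  have hlow : ∀ S ∈ bad, L ^ 4 ≤ T4 S := by
    intro S hS
    rw [hbad, Finset.mem_filter] at hS
    by_contra hlt
    push Not at hlt
    exact hS.2 (norm_paleyForm_le_of_trace_four_le p S L hL hlt.le)
  have h1 : ((bad.card : ℝ)) * L ^ 4 ≤ ∑ S ∈ bad, T4 S := by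
    have := Finset.card_nsmul_le_sum bad T4 (L ^ 4) hlow
    rwa [nsmul_eq_mul] at this
  have h2 : ∑ S ∈ bad, T4 S ≤ ∑ S ∈ powersetCard m (range p), T4 S :=
    Finset.sum_le_sum_of_subset_of_nonneg (Finset.filter_subset _ _) fun S _ _ =>
      Finset.sum_nonneg fun b _ => Finset.sum_nonneg fun d _ => sq_nonneg _
  exact h1.trans (h2.trans (sum_trace_four_le p m hm))


open Classical in
/-- **The engine holds for almost every support (fourth-moment form).**  For `κ, δ₁, η > 0` with
`4κ + 3δ₁ + η < 1/2` there is `p₁` such that for every prime `p ≥ p₁` and every size `m ≤ p^{1/2+δ₁}`, the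
supports `S ⊆ [0,p)` with `#S = m` on which the engine inequality
`|Q_p(S,w)| ≤ p^{1/2−κ}·Σ_{a∈S}|w_a|²` FAILS for some complex weight `w` number at most `p^{−η}·C(p,m)` —
a `p^{−η}` fraction of all supports of that size.  (The registered stub asks for NO exceptional support:
that is the Paley graph conjecture below `1/2`, open.) [folklore] -/
theorem flatRIP_randomSupport (κ δ₁ η : ℝ) (hκ : 0 < κ) (hδ₁ : 0 < δ₁) (hη : 0 < η)
    (h : 4 * κ + 3 * δ₁ + η < 1 / 2) :
    ∃ p₁ : ℕ, ∀ (p : ℕ) [Fact p.Prime], p₁ ≤ p → ∀ (m : ℕ), (m : ℝ) ≤ (p : ℝ) ^ (1 / 2 + δ₁) →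
      ((((powersetCard m (range p)).filter (fun S => ¬ ∀ w : ℕ → ℂ,
          ‖paleyForm p S w‖ ≤ (p : ℝ) ^ (1 / 2 - κ) * ∑ a ∈ S, ‖w a‖ ^ 2)).card : ℝ)) ≤
        (p : ℝ) ^ (-η) * ((p.choose m : ℕ) : ℝ) := by
  set g : ℝ := 1 / 2 - η - 4 * κ - 3 * δ₁ with hg
  have hgpos : 0 < g := by rw [hg]; linarith
  refine ⟨⌈(3078 : ℝ) ^ (1 / g)⌉₊ + 81, ?_⟩
  intro p _ hp m hm
  have hp81 : 81 ≤ p := le_trans (by omega) hp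
  have hp1 : (1 : ℝ) ≤ (p : ℝ) := by exact_mod_cast (show 1 ≤ p by omega)
  have hp0 : (0 : ℝ) < (p : ℝ) := by linarith
  have hpR : ((⌈(3078 : ℝ) ^ (1 / g)⌉₊ + 81 : ℕ) : ℝ) ≤ (p : ℝ) := by exact_mod_cast hp
  push_cast at hpR
  -- `3078 ≤ p^g`
  have h3078 : (3078 : ℝ) ≤ (p : ℝ) ^ g := by
    have hle : (3078 : ℝ) ^ (1 / g) ≤ (p : ℝ) := by
      have := Nat.le_ceil ((3078 : ℝ) ^ (1 / g)); linarith
    have h0 : (0 : ℝ) ≤ (3078 : ℝ) ^ (1 / g) := Real.rpow_nonneg (by norm_num) _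
    have hmono : ((3078 : ℝ) ^ (1 / g)) ^ g ≤ (p : ℝ) ^ g := Real.rpow_le_rpow h0 hle hgpos.le
    have hid : ((3078 : ℝ) ^ (1 / g)) ^ g = 3078 := by
      rw [← Real.rpow_mul (by norm_num), one_div, inv_mul_cancel₀ hgpos.ne', Real.rpow_one]
    rwa [hid] at hmono
  set L : ℝ := (p : ℝ) ^ (1 / 2 - κ) with hL
  have hL0 : 0 ≤ L := Real.rpow_nonneg hp0.le _
  have hL4 : L ^ 4 = (p : ℝ) ^ (2 - 4 * κ) := by
    rw [hL, ← Real.rpow_natCast, ← Real.rpow_mul hp0.le]; norm_num; ring_nf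
  set bad := (powersetCard m (range p)).filter (fun S => ¬ ∀ w : ℕ → ℂ,
    ‖paleyForm p S w‖ ≤ L * ∑ a ∈ S, ‖w a‖ ^ 2) with hbad
  have hRHS0 : (0 : ℝ) ≤ (p : ℝ) ^ (-η) * ((p.choose m : ℕ) : ℝ) :=
    mul_nonneg (Real.rpow_nonneg hp0.le _) (Nat.cast_nonneg _)
  show ((bad.card : ℝ)) ≤ (p : ℝ) ^ (-η) * ((p.choose m : ℕ) : ℝ)
  -- small sizes: no bad support at all
  by_cases hm4 : m < 4
  · have hempty : bad = ∅ := by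
      rw [hbad, Finset.filter_eq_empty_iff]
      intro S hS hneg
      apply hneg
      intro w
      have hSm : S.card = m := (mem_powersetCard.1 hS).2
      refine norm_paleyForm_le_of_trace_four_le p S L hL0 ?_ w
      calc _ ≤ (S.card : ℝ) ^ 4 := trace_four_le_card_pow p S
        _ ≤ (3 : ℝ) ^ 4 := by
            refine pow_le_pow_left₀ (Nat.cast_nonneg _) ?_ 4
            exact_mod_cast (show S.card ≤ 3 by omega)
        _ ≤ (p : ℝ) := by norm_num; exact_mod_cast hp81
        _ = (p : ℝ) ^ (1 : ℝ) := (Real.rpow_one _).symm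
        _ ≤ (p : ℝ) ^ (2 - 4 * κ) := Real.rpow_le_rpow_of_exponent_le hp1 (by linarith)
        _ = L ^ 4 := hL4.symm
    rw [hempty, Finset.card_empty, Nat.cast_zero]
    exact hRHS0
  push Not at hm4
  -- sizes beyond `p`: no support at all
  by_cases hmp : p < m
  · have hempty : bad = ∅ := by
      rw [hbad, Finset.powersetCard_eq_empty.2 (by rw [card_range]; exact hmp), Finset.filter_empty]
    rw [hempty, Finset.card_empty, Nat.cast_zero]
    exact hRHS0
  -- the Markov bound
  have hM := card_badSupports_mul_le p m hm4 L hL0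
  rw [← hbad, hL4] at hM
  have hCh := choose_sub_four_le p m hm4 (by omega)
  have hCm0 : (0 : ℝ) ≤ ((p.choose m : ℕ) : ℝ) := Nat.cast_nonneg _
  -- `m⁴ ≤ p^{2+4δ₁}`, `m³ ≤ p^{3/2+3δ₁}`
  have hm0 : (0 : ℝ) ≤ (m : ℝ) := Nat.cast_nonneg _
  have hm4R : (m : ℝ) ^ 4 ≤ (p : ℝ) ^ (2 + 4 * δ₁) := by
    calc (m : ℝ) ^ 4 ≤ ((p : ℝ) ^ (1 / 2 + δ₁)) ^ 4 := pow_le_pow_left₀ hm0 hm 4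
      _ = (p : ℝ) ^ (2 + 4 * δ₁) := by
          rw [← Real.rpow_natCast, ← Real.rpow_mul hp0.le]; norm_num; ring_nf
  have hm3R : (m : ℝ) ^ 3 ≤ (p : ℝ) ^ (3 / 2 + 3 * δ₁) := by
    calc (m : ℝ) ^ 3 ≤ ((p : ℝ) ^ (1 / 2 + δ₁)) ^ 3 := pow_le_pow_left₀ hm0 hm 3
      _ = (p : ℝ) ^ (3 / 2 + 3 * δ₁) := by
          rw [← Real.rpow_natCast, ← Real.rpow_mul hp0.le]; norm_num; ring_nf
  -- assemble: `#bad · p^{2−4κ} ≤ (3072 p^{1+4δ₁} + 6 p^{3/2+3δ₁}) C(p,m) ≤ 3078 p^{3/2+3δ₁} C(p,m)`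
  have hp4 : (p : ℝ) ^ 4 = (p : ℝ) ^ (4 : ℝ) := by rw [← Real.rpow_natCast]; norm_num
  have hstep1 : 8 * (p : ℝ) ^ 3 * (((p - 4).choose (m - 4) : ℕ) : ℝ) ≤
      3072 * (p : ℝ) ^ (1 + 4 * δ₁ : ℝ) * ((p.choose m : ℕ) : ℝ) := by
    have hp3 : (p : ℝ) ^ 3 = (p : ℝ) ^ (3 : ℝ) := by rw [← Real.rpow_natCast]; norm_num
    calc 8 * (p : ℝ) ^ 3 * (((p - 4).choose (m - 4) : ℕ) : ℝ)
        ≤ 8 * (p : ℝ) ^ 3 * (384 * ((m : ℝ) ^ 4 / (p : ℝ) ^ 4) * ((p.choose m : ℕ) : ℝ)) :=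
          mul_le_mul_of_nonneg_left hCh (by positivity)
      _ = 3072 * ((p : ℝ) ^ 3 / (p : ℝ) ^ 4) * (m : ℝ) ^ 4 * ((p.choose m : ℕ) : ℝ) := by
          field_simp; ring
      _ ≤ 3072 * ((p : ℝ) ^ 3 / (p : ℝ) ^ 4) * (p : ℝ) ^ (2 + 4 * δ₁) * ((p.choose m : ℕ) : ℝ) :=
          mul_le_mul_of_nonneg_right (mul_le_mul_of_nonneg_left hm4R (by positivity)) hCm0
      _ = 3072 * (p : ℝ) ^ (1 + 4 * δ₁ : ℝ) * ((p.choose m : ℕ) : ℝ) := by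
          rw [hp3, hp4, ← Real.rpow_sub hp0, show ((3 : ℝ) - 4) = -1 by norm_num, mul_assoc (3072 : ℝ),
            ← Real.rpow_add hp0, show (-1 : ℝ) + (2 + 4 * δ₁) = 1 + 4 * δ₁ by ring]
  have hstep2 : 6 * (m : ℝ) ^ 3 * ((p.choose m : ℕ) : ℝ) ≤
      6 * (p : ℝ) ^ (3 / 2 + 3 * δ₁) * ((p.choose m : ℕ) : ℝ) :=
    mul_le_mul_of_nonneg_right (mul_le_mul_of_nonneg_left hm3R (by norm_num)) hCm0
  have hexp1 : (p : ℝ) ^ (1 + 4 * δ₁ : ℝ) ≤ (p : ℝ) ^ (3 / 2 + 3 * δ₁) :=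
    Real.rpow_le_rpow_of_exponent_le hp1 (by linarith)
  have htot : ((bad.card : ℝ)) * (p : ℝ) ^ (2 - 4 * κ) ≤
      3078 * (p : ℝ) ^ (3 / 2 + 3 * δ₁) * ((p.choose m : ℕ) : ℝ) := by
    have := hM.trans (add_le_add hstep1 hstep2)
    nlinarith [mul_le_mul_of_nonneg_right (mul_le_mul_of_nonneg_left hexp1 (by norm_num : (0:ℝ) ≤ 3072)) hCm0]
  -- divide by `p^{2−4κ}` and use `3078 ≤ p^g`
  have hkey : 3078 * (p : ℝ) ^ (3 / 2 + 3 * δ₁) ≤ (p : ℝ) ^ (-η) * (p : ℝ) ^ (2 - 4 * κ) := by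
    have hsplit : (p : ℝ) ^ (-η) * (p : ℝ) ^ (2 - 4 * κ) = (p : ℝ) ^ g * (p : ℝ) ^ (3 / 2 + 3 * δ₁) := by
      rw [← Real.rpow_add hp0, ← Real.rpow_add hp0]; congr 1; rw [hg]; ring
    rw [hsplit]
    exact mul_le_mul_of_nonneg_right h3078 (Real.rpow_nonneg hp0.le _)
  have hpow : (0 : ℝ) < (p : ℝ) ^ (2 - 4 * κ) := Real.rpow_pos_of_pos hp0 _
  have hfin : ((bad.card : ℝ)) * (p : ℝ) ^ (2 - 4 * κ) ≤
      ((p : ℝ) ^ (-η) * ((p.choose m : ℕ) : ℝ)) * (p : ℝ) ^ (2 - 4 * κ) := by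
    calc ((bad.card : ℝ)) * (p : ℝ) ^ (2 - 4 * κ) ≤ 3078 * (p : ℝ) ^ (3 / 2 + 3 * δ₁) * ((p.choose m : ℕ) : ℝ) :=
          htot
      _ ≤ ((p : ℝ) ^ (-η) * (p : ℝ) ^ (2 - 4 * κ)) * ((p.choose m : ℕ) : ℝ) :=
          mul_le_mul_of_nonneg_right hkey hCm0
      _ = ((p : ℝ) ^ (-η) * ((p.choose m : ℕ) : ℝ)) * (p : ℝ) ^ (2 - 4 * κ) := by ring
  exact le_of_mul_le_mul_right hfin hpow

end RandomSupport

section Existence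

open Classical in
/-- **Flat Paley–Hankel blocks beyond `√p` EXIST at every admissible size** (`4κ + 3δ₁ < 1/2`, `p` large,
`m ≤ min(p, p^{1/2+δ₁})`): some `S ⊆ [0,p)` with `#S = m` satisfies the engine inequality for all complex `w`
(non-constructive, from `flatRIP_randomSupport`); the stub asks this of EVERY support — open. [folklore] -/
theorem exists_flatSupport (κ δ₁ : ℝ) (hκ : 0 < κ) (hδ₁ : 0 < δ₁) (h : 4 * κ + 3 * δ₁ < 1 / 2) :
    ∃ p₁ : ℕ, ∀ (p : ℕ) [Fact p.Prime], p₁ ≤ p → ∀ (m : ℕ), m ≤ p → (m : ℝ) ≤ (p : ℝ) ^ (1 / 2 + δ₁) →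
      ∃ S : Finset ℕ, S ⊆ range p ∧ S.card = m ∧
        ∀ w : ℕ → ℂ, ‖paleyForm p S w‖ ≤ (p : ℝ) ^ (1 / 2 - κ) * ∑ a ∈ S, ‖w a‖ ^ 2 := by
  set η : ℝ := (1 / 2 - 4 * κ - 3 * δ₁) / 2 with hη
  have hηpos : 0 < η := by rw [hη]; linarith
  have hsum : 4 * κ + 3 * δ₁ + η < 1 / 2 := by rw [hη]; linarith
  obtain ⟨p₁, hp₁⟩ := flatRIP_randomSupport κ δ₁ η hκ hδ₁ hηpos hsum
  refine ⟨p₁ + 2, fun p _ hp m hmp hm => ?_⟩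
  have hcard := hp₁ p (by omega) m hm
  set 𝒮 := powersetCard m (range p) with h𝒮
  set bad := 𝒮.filter (fun S => ¬ ∀ w : ℕ → ℂ,
    ‖paleyForm p S w‖ ≤ (p : ℝ) ^ (1 / 2 - κ) * ∑ a ∈ S, ‖w a‖ ^ 2) with hbad
  have h𝒮card : 𝒮.card = p.choose m := by rw [h𝒮, card_powersetCard, card_range]
  -- `#bad ≤ p^{−η} C(p,m) < C(p,m) = #𝒮`
  have hp1 : (1 : ℝ) < (p : ℝ) := by exact_mod_cast (show 1 < p by omega)
  have hpη : (p : ℝ) ^ (-η) < 1 := Real.rpow_lt_one_of_one_lt_of_neg hp1 (by linarith)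
  have hCpos : (0 : ℝ) < ((p.choose m : ℕ) : ℝ) := by exact_mod_cast Nat.choose_pos hmp
  have hlt : ((bad.card : ℕ) : ℝ) < ((𝒮.card : ℕ) : ℝ) := by
    rw [h𝒮card]
    calc ((bad.card : ℕ) : ℝ) ≤ (p : ℝ) ^ (-η) * ((p.choose m : ℕ) : ℝ) := hcard
      _ < 1 * ((p.choose m : ℕ) : ℝ) := mul_lt_mul_of_pos_right hpη hCpos
      _ = ((p.choose m : ℕ) : ℝ) := one_mul _
  have hlt' : bad.card < 𝒮.card := by exact_mod_cast hlt
  obtain ⟨S, hS𝒮, hSbad⟩ := Finset.exists_mem_notMem_of_card_lt_card hlt'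
  refine ⟨S, (mem_powersetCard.1 hS𝒮).1, (mem_powersetCard.1 hS𝒮).2, ?_⟩
  by_contra hw
  exact hSbad (Finset.mem_filter.2 ⟨hS𝒮, hw⟩)

end Existence

end

end Summit.ValiantsHypothesis.ValiantsHypothesis.Theorems.FeketeSOSHardPaleyRIP
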